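import Summits.CriticalPhenomena.Ising3DConformalLimit.Theses.ModularQuarterTurn
import Summits.CriticalPhenomena.Ising3DConformalLimit.Theorems.MoebiusLimitExists.Negative.FreePermutations
import Summits.CriticalPhenomena.Ising3DConformalLimit.Theorems.HyperoctahedralRPInversionUpgradeNormalisedOSLayer
import Literature.MathematicalPhysics.QuantumFieldTheory.OSLorentzInvariance
import Literature.Geometry.Euclidean.AxisRotationsGenerate
import HarnessLib

/-!
# Route ModularQuarterTurn — support item `AxialRotationUpgrade` (stmt-CriticalPhenomena-6496)

THEOREM-ONLY file.  **Group bookkeeping for rotations.**  Let `S` be a normalised,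
translation-invariant pointwise scaling limit of the critical correlators `criticalCorr 3` on `ℤ³`, and
suppose that the values of `S n` at the cylindrical configurations
`cyl(c, p)_i = (r_i cos (c + θ_i), r_i sin (c + θ_i), z_i)`, `θ_i = Σ_{j<i} φ_j`, do not depend on the
common offset `c` whenever the gaps `φ_i ≥ 0` sum to `2π`, the radii `r_i` are positive and `cyl(0, p)`
is non-coincident (the exact shape of the conclusion of the crux `WedgeModularRotation`).  Then `S` is
`IsRotationInvariant` (all of `O(3)`, all configurations).

Proof.
* `S` is symmetric in its arguments and invariant under the coordinate permutations of `ℝ³`: both are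
  exact lattice symmetries commuting with `⌊·/δ⌋`, inherited by any pointwise limit (tree:
  `isPermutationSymmetric_of_limit`, `MoebiusLimitExistsNegative.limit_coordPerm`), extended to
  coincident configurations by the normalisation `S = 0` off `NonCoincident`.
* Rotations about the `x₂`-axis (`planeRot 0 α`).  For a non-coincident configuration off the axis
  write `y_i = (r_i cos ψ_i, r_i sin ψ_i, z_i)` with `ψ_i = arg (y_i⁰ + i y_i¹) ∈ (-π, π]`; after sorting
  the indices by `ψ` (`Tuple.sort`, harmless by permutation symmetry) the successive differences
  `φ_j = ψ_{j+1} - ψ_j` (and `φ_{n-1} = 2π - (ψ_{n-1} - ψ_0)`) are admissible gaps with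
  `cyl(c, p) = planeRot 0 (ψ_0 - c) ∘ y` (telescoping), so the hypothesis with `c = ψ_0`,
  `c' = ψ_0 - α` is the claim.  Points on the axis are removed by a translation along `e₀`
  (translation invariance; rotations are linear), coincident configurations by the normalisation.
* Rotations about the `x₁`-axis are conjugates of these by the coordinate transposition `(1 2)`, and the
  coordinate reflection `x ↦ (-x₀, x₁, x₂)` is `(0 1) ∘ planeRot 0 (π/2)`; rotations about two axes and
  one reflection generate `O(3)` (Cartan–Dieudonné, tree
  `Literature.Geometry.Euclidean.apply_comp_eq_of_axisRotations`).
-/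

noncomputable section

open Literature.Probability.LatticeModels Literature.MathematicalPhysics.QuantumFieldTheory Filter Set
open Summit.CriticalPhenomena.Ising3DConformalLimit.MoebiusLimitExistsNegative (coordPerm_apply
  limit_coordPerm map_mem_nonCoincident_iff)
open Summit.CriticalPhenomena.Ising3DConformalLimit.Cruxes.InversionUpgradeNormalised.FreeEndpointGaussianClosure
  (isPermutationSymmetric_of_limit)

namespace Summit.CriticalPhenomena.Ising3DConformalLimit.ModularQuarterTurnAxial

/-! ### Telescoping gaps of a sorted angle sequence -/

/-- Partial sums over `Fin n` of successive differences of `g : ℕ → ℝ` telescope: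
`Σ_{j<i} (g (j+1) - g j) = g i - g 0`. [folklore] -/
theorem sum_ite_lt_sub_eq {n : ℕ} (g : ℕ → ℝ) (i : Fin n) :
    (∑ j : Fin n, if j < i then g ((j : ℕ) + 1) - g j else 0) = g i - g 0 := by
  have h1 : (∑ j : Fin n, if j < i then g ((j : ℕ) + 1) - g j else 0) =
      ∑ j : Fin n, (if (j : ℕ) < (i : ℕ) then g ((j : ℕ) + 1) - g j else 0) := by
    refine Finset.sum_congr rfl fun j _ => ?_
    simp only [Fin.lt_def]
  rw [h1, Fin.sum_univ_eq_sum_range (fun k => if k < (i : ℕ) then g (k + 1) - g k else 0) n,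
    ← Finset.sum_filter]
  have hr : (Finset.range n).filter (fun k => k < (i : ℕ)) = Finset.range i := by
    ext k
    simp only [Finset.mem_filter, Finset.mem_range]
    constructor
    · exact fun h => h.2
    · exact fun h => ⟨lt_trans h i.isLt, h⟩
  rw [hr, Finset.sum_range_sub]

/-- The full sum of the successive differences over `Fin n` is `g n - g 0`. [folklore] -/
theorem sum_sub_eq {n : ℕ} (g : ℕ → ℝ) :
    (∑ j : Fin n, (g ((j : ℕ) + 1) - g j)) = g n - g 0 := by
  rw [Fin.sum_univ_eq_sum_range (fun k => g (k + 1) - g k) n, Finset.sum_range_sub]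

/-! ### The rotation about the `x₂`-axis in polar form -/

/-- `planeRot 0 β` rotates the horizontal polar angle by `-β`:
`planeRot 0 β (r cos ψ, r sin ψ, z) = (r cos (ψ - β), r sin (ψ - β), z)`. [folklore] -/
theorem planeRot_zero_polar (β r ψ : ℝ) (y : EuclideanSpace ℝ (Fin 3))
    (h0 : y 0 = r * Real.cos ψ) (h1 : y 1 = r * Real.sin ψ) :
    planeRot (d := 2) 0 β y =
      (WithLp.toLp 2 ![r * Real.cos (ψ - β), r * Real.sin (ψ - β), y 2] : EuclideanSpace ℝ (Fin 3)) := by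
  ext j
  fin_cases j
  · simp [planeRot_apply, h0, h1, Real.cos_sub]
    ring
  · simp [planeRot_apply, h0, h1, Real.sin_sub]
    ring
  · simp [planeRot_apply]

/-! ### Axial rotations from offset-independence of the cylindrical words -/

/-- **Sorted, off-axis case.**  If the angle-interpolated values of `S n` do not depend on the common
offset (hypothesis `hW`, the shape of the conclusion of `WedgeModularRotation`), then for an injective
configuration `y` with polar data `(r_i > 0, ψ_i ∈ (-π, π])` in the horizontal plane and `ψ` monotone
in the index, `S n` is invariant under every rotation `planeRot 0 α` about the `x₂`-axis at `y`: the
successive differences of `ψ` (closed up by `2π - (ψ_{n-1} - ψ_0)`) are admissible gaps whose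
cylindrical configuration at offset `c` is `planeRot 0 (ψ_0 - c) ∘ y`. [folklore] -/
theorem rot_eq_of_sorted {S : CorrFamily 3} {n : ℕ}
    (hW : ∀ (c c' : ℝ) (p : Fin n → ℝ × ℝ × ℝ),
      (∀ i, 0 ≤ (p i).1 ∧ 0 < (p i).2.1) → ∑ i, (p i).1 = 2 * Real.pi →
      (fun i : Fin n => (WithLp.toLp 2 ![(p i).2.1 * Real.cos (∑ j : Fin n, if j < i then (p j).1 else 0),
        (p i).2.1 * Real.sin (∑ j : Fin n, if j < i then (p j).1 else 0), (p i).2.2] :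
          EuclideanSpace ℝ (Fin 3))) ∈ NonCoincident 3 n →
      S n (fun i : Fin n => (WithLp.toLp 2
        ![(p i).2.1 * Real.cos (c + ∑ j : Fin n, if j < i then (p j).1 else 0),
          (p i).2.1 * Real.sin (c + ∑ j : Fin n, if j < i then (p j).1 else 0), (p i).2.2] :
          EuclideanSpace ℝ (Fin 3))) =
      S n (fun i : Fin n => (WithLp.toLp 2
        ![(p i).2.1 * Real.cos (c' + ∑ j : Fin n, if j < i then (p j).1 else 0),
          (p i).2.1 * Real.sin (c' + ∑ j : Fin n, if j < i then (p j).1 else 0), (p i).2.2] :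
          EuclideanSpace ℝ (Fin 3))))
    (y : Fin n → EuclideanSpace ℝ (Fin 3)) (hy : Function.Injective y) (r ψ : Fin n → ℝ)
    (hr : ∀ i, 0 < r i) (h0 : ∀ i, y i 0 = r i * Real.cos (ψ i)) (h1 : ∀ i, y i 1 = r i * Real.sin (ψ i))
    (hψ : ∀ i, -Real.pi < ψ i ∧ ψ i ≤ Real.pi) (hmono : Monotone ψ) (α : ℝ) :
    S n (fun i => planeRot (d := 2) 0 α (y i)) = S n y := by
  rcases Nat.eq_zero_or_pos n with hn | hn
  · subst hn
    have : (fun i => planeRot (d := 2) 0 α (y i)) = y := funext fun i => Fin.elim0 i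
    rw [this]
  set i₀ : Fin n := ⟨0, hn⟩ with hi₀
  -- the angle sequence extended by `ψ 0 + 2π` at index `n`
  set g : ℕ → ℝ := fun k => if h : k < n then ψ ⟨k, h⟩ else ψ i₀ + 2 * Real.pi with hg
  have hg_of_lt : ∀ (k : ℕ) (hk : k < n), g k = ψ ⟨k, hk⟩ := fun k hk => by
    simp only [hg, dif_pos hk]
  have hg_fin : ∀ i : Fin n, g i = ψ i := fun i => by rw [hg_of_lt i i.isLt]
  have hg_n : g n = ψ i₀ + 2 * Real.pi := by simp only [hg, lt_irrefl, dif_neg, not_false_eq_true]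
  have hg_zero : g 0 = ψ i₀ := by rw [hg_of_lt 0 hn]
  -- the gaps and the parameter point
  set p : Fin n → ℝ × ℝ × ℝ := fun j => (g ((j : ℕ) + 1) - g j, r j, y j 2) with hp
  have hpartial : ∀ i : Fin n, (∑ j : Fin n, if j < i then (p j).1 else 0) = ψ i - ψ i₀ := by
    intro i
    have := sum_ite_lt_sub_eq g i
    rw [hg_fin, hg_zero] at this
    exact this
  have htotal : ∑ i, (p i).1 = 2 * Real.pi := by
    have := sum_sub_eq (n := n) g
    rw [hg_n, hg_zero] at this
    simp only [hp]
    linarith [this]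
  have hnonneg : ∀ i, 0 ≤ (p i).1 ∧ 0 < (p i).2.1 := by
    intro i
    refine ⟨?_, hr i⟩
    show 0 ≤ g ((i : ℕ) + 1) - g i
    rw [hg_fin]
    by_cases hi : (i : ℕ) + 1 < n
    · rw [hg_of_lt _ hi]
      have hle : i ≤ ⟨(i : ℕ) + 1, hi⟩ := by
        rw [Fin.le_def]
        exact Nat.le_succ _
      linarith [hmono hle]
    · have : g ((i : ℕ) + 1) = ψ i₀ + 2 * Real.pi := by simp only [hg, dif_neg hi]
      rw [this]
      linarith [(hψ i).2, (hψ i₀).1]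
  -- the cylindrical configurations are rotated copies of `y`
  have hcfg : ∀ c : ℝ, (fun i : Fin n => (WithLp.toLp 2
      ![(p i).2.1 * Real.cos (c + ∑ j : Fin n, if j < i then (p j).1 else 0),
        (p i).2.1 * Real.sin (c + ∑ j : Fin n, if j < i then (p j).1 else 0), (p i).2.2] :
        EuclideanSpace ℝ (Fin 3))) = fun i => planeRot (d := 2) 0 (ψ i₀ - c) (y i) := by
    intro c
    funext i
    rw [hpartial i, planeRot_zero_polar (ψ i₀ - c) (r i) (ψ i) (y i) (h0 i) (h1 i)]
    have e : c + (ψ i - ψ i₀) = ψ i - (ψ i₀ - c) := by ring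
    rw [e]
  have hcfg0 : (fun i : Fin n => (WithLp.toLp 2
      ![(p i).2.1 * Real.cos (∑ j : Fin n, if j < i then (p j).1 else 0),
        (p i).2.1 * Real.sin (∑ j : Fin n, if j < i then (p j).1 else 0), (p i).2.2] :
        EuclideanSpace ℝ (Fin 3))) = fun i => planeRot (d := 2) 0 (ψ i₀) (y i) := by
    have := hcfg 0
    simp only [zero_add, sub_zero] at this
    exact this
  have hmem : (fun i : Fin n => (WithLp.toLp 2
      ![(p i).2.1 * Real.cos (∑ j : Fin n, if j < i then (p j).1 else 0),
        (p i).2.1 * Real.sin (∑ j : Fin n, if j < i then (p j).1 else 0), (p i).2.2] :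
        EuclideanSpace ℝ (Fin 3))) ∈ NonCoincident 3 n := by
    rw [hcfg0]
    exact (map_mem_nonCoincident_iff _ y).2 hy
  have key := hW (ψ i₀) (ψ i₀ - α) p hnonneg htotal hmem
  rw [hcfg, hcfg] at key
  simp only [sub_self, sub_sub_cancel, planeRot_zero_apply] at key
  exact key.symm

/-- **Off-axis case.**  Same conclusion for every injective configuration avoiding the `x₂`-axis, for a
family symmetric in its arguments: sort the indices by the polar angle (`Tuple.sort`). [folklore] -/
theorem rot_eq_of_offaxis {S : CorrFamily 3} {n : ℕ}
    (hW : ∀ (c c' : ℝ) (p : Fin n → ℝ × ℝ × ℝ),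
      (∀ i, 0 ≤ (p i).1 ∧ 0 < (p i).2.1) → ∑ i, (p i).1 = 2 * Real.pi →
      (fun i : Fin n => (WithLp.toLp 2 ![(p i).2.1 * Real.cos (∑ j : Fin n, if j < i then (p j).1 else 0),
        (p i).2.1 * Real.sin (∑ j : Fin n, if j < i then (p j).1 else 0), (p i).2.2] :
          EuclideanSpace ℝ (Fin 3))) ∈ NonCoincident 3 n →
      S n (fun i : Fin n => (WithLp.toLp 2
        ![(p i).2.1 * Real.cos (c + ∑ j : Fin n, if j < i then (p j).1 else 0),
          (p i).2.1 * Real.sin (c + ∑ j : Fin n, if j < i then (p j).1 else 0), (p i).2.2] :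
          EuclideanSpace ℝ (Fin 3))) =
      S n (fun i : Fin n => (WithLp.toLp 2
        ![(p i).2.1 * Real.cos (c' + ∑ j : Fin n, if j < i then (p j).1 else 0),
          (p i).2.1 * Real.sin (c' + ∑ j : Fin n, if j < i then (p j).1 else 0), (p i).2.2] :
          EuclideanSpace ℝ (Fin 3))))
    (hperm : ∀ (σ : Equiv.Perm (Fin n)) (x : Fin n → EuclideanSpace ℝ (Fin 3)), S n (x ∘ σ) = S n x)
    (y : Fin n → EuclideanSpace ℝ (Fin 3)) (hy : Function.Injective y)
    (hoff : ∀ i, (⟨y i 0, y i 1⟩ : ℂ) ≠ 0) (α : ℝ) :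
    S n (fun i => planeRot (d := 2) 0 α (y i)) = S n y := by
  -- polar data
  set r : Fin n → ℝ := fun i => ‖(⟨y i 0, y i 1⟩ : ℂ)‖ with hr
  set ψ : Fin n → ℝ := fun i => Complex.arg ⟨y i 0, y i 1⟩ with hψ
  have hr_pos : ∀ i, 0 < r i := fun i => norm_pos_iff.2 (hoff i)
  have h0 : ∀ i, y i 0 = r i * Real.cos (ψ i) := fun i =>
    (Complex.norm_mul_cos_arg ⟨y i 0, y i 1⟩).symm
  have h1 : ∀ i, y i 1 = r i * Real.sin (ψ i) := fun i =>
    (Complex.norm_mul_sin_arg ⟨y i 0, y i 1⟩).symm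
  have hbd : ∀ i, -Real.pi < ψ i ∧ ψ i ≤ Real.pi := fun i =>
    ⟨Complex.neg_pi_lt_arg _, Complex.arg_le_pi _⟩
  -- sort the indices by the angle
  set σ : Equiv.Perm (Fin n) := Tuple.sort ψ with hσ
  have hmono : Monotone (ψ ∘ σ) := Tuple.monotone_sort ψ
  have hsorted := rot_eq_of_sorted hW (y ∘ σ) (hy.comp σ.injective) (r ∘ σ) (ψ ∘ σ)
    (fun i => hr_pos (σ i)) (fun i => h0 (σ i)) (fun i => h1 (σ i)) (fun i => hbd (σ i)) hmono α
  rw [← hperm σ y, ← hperm σ (fun i => planeRot (d := 2) 0 α (y i))]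
  exact hsorted

/-- **All configurations.**  With translation invariance and the normalisation `S = 0` off
`NonCoincident`, the invariance under `planeRot 0 α` extends to every configuration: a translation
along `e₀` moves a non-coincident configuration off the axis (rotations are linear, so they commute with
translations up to a translation), and at coincident configurations both sides vanish. [folklore] -/
theorem rot_eq {S : CorrFamily 3} {n : ℕ}
    (hW : ∀ (c c' : ℝ) (p : Fin n → ℝ × ℝ × ℝ),
      (∀ i, 0 ≤ (p i).1 ∧ 0 < (p i).2.1) → ∑ i, (p i).1 = 2 * Real.pi →
      (fun i : Fin n => (WithLp.toLp 2 ![(p i).2.1 * Real.cos (∑ j : Fin n, if j < i then (p j).1 else 0),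
        (p i).2.1 * Real.sin (∑ j : Fin n, if j < i then (p j).1 else 0), (p i).2.2] :
          EuclideanSpace ℝ (Fin 3))) ∈ NonCoincident 3 n →
      S n (fun i : Fin n => (WithLp.toLp 2
        ![(p i).2.1 * Real.cos (c + ∑ j : Fin n, if j < i then (p j).1 else 0),
          (p i).2.1 * Real.sin (c + ∑ j : Fin n, if j < i then (p j).1 else 0), (p i).2.2] :
          EuclideanSpace ℝ (Fin 3))) =
      S n (fun i : Fin n => (WithLp.toLp 2
        ![(p i).2.1 * Real.cos (c' + ∑ j : Fin n, if j < i then (p j).1 else 0),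
          (p i).2.1 * Real.sin (c' + ∑ j : Fin n, if j < i then (p j).1 else 0), (p i).2.2] :
          EuclideanSpace ℝ (Fin 3))))
    (hperm : ∀ (σ : Equiv.Perm (Fin n)) (x : Fin n → EuclideanSpace ℝ (Fin 3)), S n (x ∘ σ) = S n x)
    (htr : ∀ (v : EuclideanSpace ℝ (Fin 3)) (x : Fin n → EuclideanSpace ℝ (Fin 3)),
      S n (fun i => x i + v) = S n x)
    (hnorm : ∀ z : Fin n → EuclideanSpace ℝ (Fin 3), z ∉ NonCoincident 3 n → S n z = 0)
    (α : ℝ) (x : Fin n → EuclideanSpace ℝ (Fin 3)) :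
    S n (fun i => planeRot (d := 2) 0 α (x i)) = S n x := by
  by_cases hx : x ∈ NonCoincident 3 n
  · -- translate along `e₀` off the axis
    set t : ℝ := 1 + ∑ j, |x j 0| with ht
    set v : EuclideanSpace ℝ (Fin 3) := WithLp.toLp 2 ![t, 0, 0] with hv
    have hpos : ∀ i, 0 < x i 0 + t := by
      intro i
      have h1 : |x i 0| ≤ ∑ j, |x j 0| :=
        Finset.single_le_sum (f := fun j => |x j 0|) (fun j _ => abs_nonneg _) (Finset.mem_univ i)
      have h2 : -|x i 0| ≤ x i 0 := neg_abs_le _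
      linarith
    have hoff : ∀ i, (⟨(x i + v) 0, (x i + v) 1⟩ : ℂ) ≠ 0 := by
      intro i h
      have hre := congrArg Complex.re h
      simp only [hv, PiLp.add_apply, Matrix.cons_val_zero, Complex.zero_re] at hre
      linarith [hpos i]
    have hinj : Function.Injective (fun i => x i + v) := fun i j h => hx (add_right_cancel h)
    have hoffaxis := rot_eq_of_offaxis hW hperm (fun i => x i + v) hinj hoff α
    have hlin : (fun i => planeRot (d := 2) 0 α (x i + v)) =
        fun i => planeRot (d := 2) 0 α (x i) + planeRot (d := 2) 0 α v :=
      funext fun i => map_add _ _ _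
    rw [hlin, htr, htr] at hoffaxis
    exact hoffaxis
  · have hx' : (fun i => planeRot (d := 2) 0 α (x i)) ∉ NonCoincident 3 n :=
      fun h => hx ((map_mem_nonCoincident_iff (planeRot (d := 2) 0 α) x).1 h)
    rw [hnorm _ hx', hnorm _ hx]

/-! ### The item -/

/-- **`AxialRotationUpgrade` (route ModularQuarterTurn, item stmt-CriticalPhenomena-6496).**  A normalised,
translation-invariant pointwise scaling limit `S` of `criticalCorr 3` whose values at the cylindrical
configurations `(r_i cos (c + θ_i), r_i sin (c + θ_i), z_i)`, `θ_i = Σ_{j<i} φ_j`, are independent of the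
offset `c` on the wedge domain is `O(3)`-invariant: permutation symmetry and coordinate-permutation
invariance come from the lattice (`isPermutationSymmetric_of_limit`, `limit_coordPerm`), the axial
rotations from the hypothesis (`rot_eq`), the second axis and the coordinate reflection by conjugation
with coordinate permutations, and two axes plus one reflection generate `O(3)`
(`Literature.Geometry.Euclidean.apply_comp_eq_of_axisRotations`). -/
theorem axialRotationUpgrade_proof :
    Summit.CriticalPhenomena.Ising3DConformalLimit.Theses.ModularQuarterTurn.AxialRotationUpgrade := by
  intro ρ Δ S _hρ _hΔ hlim hnorm _hnd htr _hsc hwedge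
  have hperm : IsPermutationSymmetric S := isPermutationSymmetric_of_limit hlim hnorm
  -- coordinate permutations of `ℝ³`, at every configuration
  have hP : ∀ (τ : Equiv.Perm (Fin 3)) (n : ℕ) (x : Fin n → EuclideanSpace ℝ (Fin 3)),
      S n (fun i => LinearIsometryEquiv.piLpCongrLeft 2 ℝ ℝ τ (x i)) = S n x := by
    intro τ n x
    by_cases hx : x ∈ NonCoincident 3 n
    · exact limit_coordPerm hlim τ hx
    · have hx' : (fun i => LinearIsometryEquiv.piLpCongrLeft 2 ℝ ℝ τ (x i)) ∉ NonCoincident 3 n :=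
        fun h => hx ((map_mem_nonCoincident_iff _ x).1 h)
      rw [hnorm n _ hx', hnorm n _ hx]
  -- rotations about the `x₂`-axis, at every configuration
  have hRz : ∀ (φ : ℝ) (n : ℕ) (x : Fin n → EuclideanSpace ℝ (Fin 3)),
      S n (fun i => planeRot (d := 2) 0 φ (x i)) = S n x := by
    intro φ n x
    refine rot_eq (S := S) (n := n) ?_ (hperm n) (htr n) (hnorm n) φ x
    intro c c' p h1 h2 h3
    exact hwedge n c c' p ⟨h1, h2, h3⟩
  intro n R x
  refine Literature.Geometry.Euclidean.apply_comp_eq_of_axisRotations (S n) ?_ ?_ ?_ R x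
  · intro φ
    refine ⟨planeRot (d := 2) 0 φ, fun y => ?_, hRz φ n⟩
    ext j
    fin_cases j <;> simp [planeRot_apply]
  · intro φ
    refine ⟨planeRot (d := 2) 1 φ, fun y => ?_, fun z => ?_⟩
    · ext j
      fin_cases j <;> simp [planeRot_apply]
    · -- `planeRot 1 φ = (1 2) ∘ planeRot 0 φ ∘ (1 2)`
      have e : (fun i => planeRot (d := 2) 1 φ (z i)) = fun i =>
          LinearIsometryEquiv.piLpCongrLeft 2 ℝ ℝ (Equiv.swap 1 2) (planeRot (d := 2) 0 φ
            (LinearIsometryEquiv.piLpCongrLeft 2 ℝ ℝ (Equiv.swap 1 2) (z i))) := by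
        funext i
        ext j
        fin_cases j <;>
          simp [planeRot_apply, coordPerm_apply, Equiv.swap_apply_of_ne_of_ne, Equiv.symm_swap,
            Equiv.swap_apply_left, Equiv.swap_apply_right]
      rw [e, hP, hRz, hP]
  · intro z
    -- `(x₀,x₁,x₂) ↦ (-x₀,x₁,x₂)` is `(0 1) ∘ planeRot 0 (π/2)`
    have e : (fun i => (WithLp.toLp 2 ![-(z i) 0, z i 1, z i 2] : EuclideanSpace ℝ (Fin 3))) = fun i =>
        LinearIsometryEquiv.piLpCongrLeft 2 ℝ ℝ (Equiv.swap 0 1)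
          (planeRot (d := 2) 0 (Real.pi / 2) (z i)) := by
      funext i
      ext j
      fin_cases j <;>
        simp [planeRot_apply, coordPerm_apply, Equiv.swap_apply_of_ne_of_ne, Equiv.symm_swap,
          Equiv.swap_apply_left, Equiv.swap_apply_right]
    rw [e, hP, hRz]

end Summit.CriticalPhenomena.Ising3DConformalLimit.ModularQuarterTurnAxial

end
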